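import Mathlib
import Summits.ValiantsHypothesis.ValiantsHypothesis.Theorems.FeketeSOSFeketeNoSparseSplitCharPFewnomial
import Summits.ValiantsHypothesis.ValiantsHypothesis.Theorems.FeketeSOSCharPSparseSOSTwoCuspTrivial
import Summits.ValiantsHypothesis.ValiantsHypothesis.Theorems.FeketeSOSCharPSparseSOSTwoCuspSLeTwo

/-!
# Crux `FeketeSOS.CharPSparseSOS` (stmt-ValiantsHypothesis-14989), line `Sketch` — the two-cusp
inequality for one fat square and two monomial squares (first cancelling case of `s = 3`)

Over a field `K` of characteristic `p`, let `P = (c₀ g₀² + c₁ g₁² + c₂ g₂²) mod (X^p − 1)` with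
`deg g_i < p`, where `g₁, g₂` are monomials (`#supp g₁, #supp g₂ ≤ 1`).  If `P ≠ 0` and `(X − 1)^D ∣ P`,
then `D ≤ 2 t + 1` with `t = #supp g₀` — a LINEAR bound, where counting monomials only gives a quadratic
one (`twoCusp_depth_le_card_support_sq`).

Proof.  Fold the two monomial squares: `N = (c₁ g₁² + c₂ g₂²) mod (X^p − 1)` has `≤ 2` monomials and
degree `< p`, and `P = F mod (X^p − 1)` with `F = c₀ g₀² + N`; since `X^p − 1 = (X − 1)^p` and
`D ≤ deg P < p`, also `(X − 1)^D ∣ F`.  Assume `D ≥ 2`, so `F(1) = 0`.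
* If `c₀ g₀(1)² = 0` then `N(1) = 0`: either `c₀ g₀² = 0` and `(X − 1)^D ∣ N` forces `D ≤ 1` by the
  char-`p` fewnomial bound `cpf_main`; or `(X − 1)² ∣ c₀ g₀²`, hence `(X − 1)² ∣ N`, so `N = 0` by
  `cpf_main` and `D + 2 ≤ 2t` by the one-square bound `tcs_depth_sq_le`.
* If `c₀ g₀(1)² ≠ 0` then `N(1) ≠ 0`.  The operator `𝒟 = 2N · d/dX − N′` satisfies
  `c₀ g₀ · 𝒟g₀ = N F′ − N′ F`, so `(X − 1)^{D−1} ∣ 𝒟g₀` (`g₀(1) ≠ 0`), and `𝒟g₀` has at most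
  `#supp N · t ≤ 2t` monomials; if its fold `V = 𝒟g₀ mod (X^p − 1)` is non-zero, `cpf_main` gives
  `D ≤ 2t`.  If `V = 0` then `X^p − 1 ∣ N F′ − N′ F ≡ N P′ − N′ P` (the derivative of `X^p − 1` vanishes
  in characteristic `p`), and the Wronskian rigidity lemma `tcm_wronskian_rigidity` applied to
  `E = P − κ N` (`κ = P(1)/N(1)`) gives `P = κ N`, whence `D ≤ 1` by `cpf_main` again.
-/

-- `Summit.ValiantsHypothesis.ValiantsHypothesis.…` is the tree's mandated single-conjunct layout (Sub = Summit).
set_option linter.dupNamespace false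

namespace Summit.ValiantsHypothesis.ValiantsHypothesis.Theorems.CharPSparseSOSTwoCusp

open Polynomial Finset
open Summit.ValiantsHypothesis.ValiantsHypothesis.Theorems.FeketeNoSparseSplitCyclic (cpf_main)

section Support

variable {R : Type*} [CommRing R]

/-- The support of `f · g′` lies in `{a + b − 1 : a ∈ supp f, b ∈ supp g}`. -/
theorem tcm_support_mul_derivative_subset (f g : R[X]) :
    (f * derivative g).support ⊆ (f.support ×ˢ g.support).image fun x => x.1 + x.2 - 1 := by
  intro n hn
  rw [Polynomial.mem_support_iff, coeff_mul] at hn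
  obtain ⟨⟨i, j⟩, hij, hne⟩ := Finset.exists_ne_zero_of_sum_ne_zero hn
  simp only [HasAntidiagonal.mem_antidiagonal] at hij
  rw [coeff_derivative] at hne
  have hi : f.coeff i ≠ 0 := left_ne_zero_of_mul hne
  have hj : g.coeff (j + 1) ≠ 0 := left_ne_zero_of_mul (right_ne_zero_of_mul hne)
  rw [mem_image]
  refine ⟨(i, j + 1), mem_product.2 ⟨Polynomial.mem_support_iff.2 hi,
    Polynomial.mem_support_iff.2 hj⟩, ?_⟩
  dsimp only
  omega

/-- The support of `f′ · g` lies in `{a + b − 1 : a ∈ supp f, b ∈ supp g}`. -/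
theorem tcm_support_derivative_mul_subset (f g : R[X]) :
    (derivative f * g).support ⊆ (f.support ×ˢ g.support).image fun x => x.1 + x.2 - 1 := by
  intro n hn
  rw [Polynomial.mem_support_iff, coeff_mul] at hn
  obtain ⟨⟨i, j⟩, hij, hne⟩ := Finset.exists_ne_zero_of_sum_ne_zero hn
  simp only [HasAntidiagonal.mem_antidiagonal] at hij
  rw [coeff_derivative] at hne
  have hi : f.coeff (i + 1) ≠ 0 := left_ne_zero_of_mul (left_ne_zero_of_mul hne)
  have hj : g.coeff j ≠ 0 := right_ne_zero_of_mul hne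
  rw [mem_image]
  refine ⟨(i + 1, j), mem_product.2 ⟨Polynomial.mem_support_iff.2 hi,
    Polynomial.mem_support_iff.2 hj⟩, ?_⟩
  dsimp only
  omega

/-- **Sparsity of the operator `𝒟_f g = 2 f g′ − f′ g`**: it has at most `#supp f · #supp g`
monomials (both products are supported on `{a + b − 1 : a ∈ supp f, b ∈ supp g}`). -/
theorem tcm_card_support_op_le (f g : R[X]) :
    (2 * (f * derivative g) - derivative f * g).support.card ≤ f.support.card * g.support.card := by
  have h1 := tcm_support_mul_derivative_subset f g
  have h2 := tcm_support_derivative_mul_subset f g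
  calc (2 * (f * derivative g) - derivative f * g).support.card
      ≤ ((f.support ×ˢ g.support).image fun x => x.1 + x.2 - 1).card := by
        refine card_le_card ?_
        rw [two_mul, sub_eq_add_neg]
        refine support_add.trans (union_subset (support_add.trans (union_subset h1 h1)) ?_)
        rw [support_neg]
        exact h2
    _ ≤ (f.support ×ˢ g.support).card := card_image_le
    _ = f.support.card * g.support.card := card_product _ _

end Support

section Fold

variable {K : Type} [Field K] (p : ℕ) [hp : Fact p.Prime]

/-- `X^p − 1` is monic. -/
theorem tcm_monic : ((X : K[X]) ^ p - 1).Monic :=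
  monic_X_pow_sub (by rw [degree_one]; exact_mod_cast hp.out.pos)

/-- A fold modulo `X^p − 1` has degree `< p`. -/
theorem tcm_natDegree_fold_lt (f : K[X]) : (f %ₘ ((X : K[X]) ^ p - 1)).natDegree < p := by
  have hq1 : ((X : K[X]) ^ p - 1) ≠ 1 := by
    intro h
    have h' := congrArg natDegree h
    rw [← C_1, natDegree_X_pow_sub_C, natDegree_C] at h'
    exact hp.out.ne_zero h'
  have h := natDegree_modByMonic_lt f (tcm_monic p) hq1
  rwa [← C_1, natDegree_X_pow_sub_C] at h

variable [CharP K p]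

/-- For `m ≤ p`, `(X − 1)^m` divides a polynomial iff it divides its fold modulo `X^p − 1 = (X − 1)^p`. -/
theorem tcm_pow_dvd_fold_iff {m : ℕ} (hm : m ≤ p) (f : K[X]) :
    (X - C (1 : K)) ^ m ∣ f %ₘ (X ^ p - 1) ↔ (X - C (1 : K)) ^ m ∣ f := by
  have h : (X - C (1 : K)) ^ m ∣ (X ^ p - 1) * (f /ₘ (X ^ p - 1)) := by
    refine dvd_mul_of_dvd_left ?_ _
    -- Frobenius: `X^p − 1 = (X − 1)^p`
    have hXp : (X - C (1 : K)) ^ p = X ^ p - 1 := by rw [sub_pow_char, ← C_pow, one_pow, C_1]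
    rw [← hXp]
    exact pow_dvd_pow _ hm
  conv_rhs => rw [← modByMonic_add_div f ((X : K[X]) ^ p - 1)]
  exact (dvd_add_left h).symm

end Fold

section Rigidity

variable {K : Type} [Field K] (p : ℕ) [Fact p.Prime] [CharP K p]

/-- **Wronskian rigidity.**  Over a field of characteristic `p`: if `N(1) ≠ 0`, `E(1) = 0`, `deg E < p`
and `X^p − 1 = (X − 1)^p ∣ N E′ − N′ E`, then `E = 0`.  (Otherwise `E = (X − 1)^e E₁` with `1 ≤ e < p`
and `E₁(1) ≠ 0`, and `N E′ − N′ E = (X − 1)^{e−1} R` with `R(1) = e · N(1) · E₁(1) ≠ 0`.) -/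
theorem tcm_wronskian_rigidity (N E : K[X]) (hN1 : N.eval 1 ≠ 0) (hE1 : E.eval 1 = 0)
    (hdegE : E.natDegree < p) (hdvd : (X : K[X]) ^ p - 1 ∣ N * derivative E - derivative N * E) :
    E = 0 := by
  -- Frobenius: `X^p − 1 = (X − 1)^p`
  have hXp : (X - C (1 : K)) ^ p = X ^ p - 1 := by rw [sub_pow_char, ← C_pow, one_pow, C_1]
  rw [← hXp] at hdvd
  by_contra hE
  have hpos : 0 < E.rootMultiplicity 1 := (rootMultiplicity_pos hE).2 hE1
  obtain ⟨e, he⟩ : ∃ e : ℕ, E.rootMultiplicity 1 = e + 1 := ⟨_, (Nat.succ_pred_eq_of_pos hpos).symm⟩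
  -- `e + 1 ≤ deg E < p`
  have hele : e + 1 ≤ E.natDegree := by
    have h := natDegree_le_of_dvd (pow_rootMultiplicity_dvd E 1) hE
    rwa [(monic_X_sub_C (1 : K)).natDegree_pow, natDegree_X_sub_C, mul_one, he] at h
  -- `E = (X − 1)^{e+1} E₁` with `E₁(1) ≠ 0`
  obtain ⟨E₁, hE₁⟩ : ∃ E₁ : K[X], E₁ = E /ₘ (X - C (1 : K)) ^ (e + 1) := ⟨_, rfl⟩
  have hfac : (X - C (1 : K)) ^ (e + 1) * E₁ = E := by
    rw [hE₁, ← he]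
    exact pow_mul_divByMonic_rootMultiplicity_eq E 1
  have hE₁1 : E₁.eval 1 ≠ 0 := by
    rw [hE₁, ← he]
    exact eval_divByMonic_pow_rootMultiplicity_ne_zero 1 hE
  -- expand the Wronskian
  have hR : N * derivative E - derivative N * E = (X - C (1 : K)) ^ e *
      (C ((e : K) + 1) * N * E₁ + (X - C 1) * (N * derivative E₁ - derivative N * E₁)) := by
    rw [← hfac, derivative_mul, derivative_pow_succ, derivative_X_sub_C]
    ring
  -- `(e + 1 : K) ≠ 0` since `0 < e + 1 < p`
  have hecast : ((e : K) + 1) ≠ 0 := by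
    intro h
    have h' : ((e + 1 : ℕ) : K) = 0 := by rw [Nat.cast_succ]; exact h
    rw [CharP.cast_eq_zero_iff K p] at h'
    have := Nat.le_of_dvd (Nat.succ_pos e) h'
    omega
  -- cancel `(X − 1)^e`: `p = e + (p − e)` with `p − e ≥ 1`
  rw [hR, show p = e + (p - e) by omega, pow_add,
    mul_dvd_mul_iff_left (pow_ne_zero e (monic_X_sub_C (1 : K)).ne_zero)] at hdvd
  have h1 := (dvd_pow_self (X - C (1 : K)) (by omega : p - e ≠ 0)).trans hdvd
  rw [dvd_iff_isRoot] at h1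
  have h2 := h1.eq_zero
  simp only [eval_add, eval_mul, eval_sub, eval_C, eval_X, sub_self, zero_mul, add_zero] at h2
  exact mul_ne_zero (mul_ne_zero hecast hN1) hE₁1 h2

end Rigidity

/-- **Two-cusp inequality for one fat square and two monomial squares (linear exponent).**  Over a field
`K` of characteristic `p`, let `P = (c₀ g₀² + c₁ g₁² + c₂ g₂²) mod (X^p − 1)` with `deg g_i < p` and
`#supp g₁, #supp g₂ ≤ 1`.  If `P ≠ 0` and `(X − 1)^D ∣ P`, then `D ≤ 2 · #supp g₀ + 1`. -/
theorem twoCuspInequality_twoMonomialSquares :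
    ∀ (K : Type) [Field K] (p : ℕ) [Fact p.Prime] [CharP K p] (c : Fin 3 → K) (g : Fin 3 → K[X])
      (P : K[X]) (D : ℕ), (∀ i, (g i).natDegree < p) → (g 1).support.card ≤ 1 →
      (g 2).support.card ≤ 1 → P = (∑ i, C (c i) * g i ^ 2) %ₘ (X ^ p - 1) → P ≠ 0 →
      (X - C (1 : K)) ^ D ∣ P → D ≤ 2 * (g 0).support.card + 1 := by
  intro K _ p _ _ c g P D hdeg hg1 hg2 hP hP0 hD
  have hprime : p.Prime := Fact.out
  have hp : 0 < p := hprime.pos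
  have hmonic : ((X : K[X]) ^ p - 1).Monic := tcm_monic p
  -- Step 0: refold the two monomial squares into `N`, `#supp N ≤ 2`, `deg N < p`.
  obtain ⟨N, hN⟩ : ∃ N : K[X], N = (C (c 1) * g 1 ^ 2 + C (c 2) * g 2 ^ 2) %ₘ (X ^ p - 1) :=
    ⟨_, rfl⟩
  have hPF : P = (C (c 0) * g 0 ^ 2 + N) %ₘ (X ^ p - 1) := by
    rw [add_modByMonic, hN, (modByMonic_eq_self_iff hmonic).2
      (degree_modByMonic_lt (C (c 1) * g 1 ^ 2 + C (c 2) * g 2 ^ 2) hmonic), hP,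
      Fin.sum_univ_three, add_assoc, add_modByMonic]
  have hdegN : N.natDegree < p := hN ▸ tcm_natDegree_fold_lt p _
  have hmono : ∀ (a : K) (f : K[X]), f.support.card ≤ 1 → (C a * f ^ 2).support.card ≤ 1 := by
    intro a f hf
    calc (C a * f ^ 2).support.card
        ≤ (f ^ 2).support.card := by
          rw [C_mul']
          exact card_le_card (support_smul a (f ^ 2))
      _ ≤ f.support.card * f.support.card := by
          rw [sq]
          exact card_support_mul_le
      _ ≤ 1 * 1 := Nat.mul_le_mul hf hf
  have hN2 : N.support.card ≤ 2 := by
    rw [hN]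
    calc ((C (c 1) * g 1 ^ 2 + C (c 2) * g 2 ^ 2) %ₘ (X ^ p - 1)).support.card
        ≤ (C (c 1) * g 1 ^ 2 + C (c 2) * g 2 ^ 2).support.card := card_support_fold_le p hp _
      _ ≤ ((C (c 1) * g 1 ^ 2).support ∪ (C (c 2) * g 2 ^ 2).support).card :=
          card_le_card support_add
      _ ≤ (C (c 1) * g 1 ^ 2).support.card + (C (c 2) * g 2 ^ 2).support.card := card_union_le _ _
      _ ≤ 1 + 1 := Nat.add_le_add (hmono _ _ hg1) (hmono _ _ hg2)
  -- Frobenius: `D ≤ deg P < p` and `(X − 1)^D` divides the refolded sum `F = c₀ g₀² + N`.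
  have hdegP : P.natDegree < p := hPF ▸ tcm_natDegree_fold_lt p _
  have hDp : D < p := by
    have h := natDegree_le_of_dvd hD hP0
    rw [(monic_X_sub_C (1 : K)).natDegree_pow, natDegree_X_sub_C, mul_one] at h
    omega
  have hDF : (X - C (1 : K)) ^ D ∣ C (c 0) * g 0 ^ 2 + N :=
    (tcm_pow_dvd_fold_iff p hDp.le _).1 (hPF ▸ hD)
  -- The bound is trivial for `D ≤ 1`.
  rcases Nat.lt_or_ge D 2 with hD1 | hD2
  · omega
  -- `F(1) = 0`.
  have hF1 : c 0 * ((g 0).eval 1) ^ 2 + N.eval 1 = 0 := by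
    have h := (dvd_iff_isRoot.1 ((dvd_pow_self _ (by omega : D ≠ 0)).trans hDF)).eq_zero
    simpa only [eval_add, eval_mul, eval_C, eval_pow] using h
  by_cases hA : c 0 * ((g 0).eval 1) ^ 2 = 0
  · -- Case A: the fat square vanishes at `1`, hence so does `N`.
    have hN1 : N.eval 1 = 0 := by rwa [hA, zero_add] at hF1
    by_cases hW0 : C (c 0) * g 0 ^ 2 = 0
    · -- dead fat square: `(X − 1)^D ∣ N ≠ 0`, so `D ≤ 1`
      rw [hW0, zero_add] at hDF hPF
      have hN0 : N ≠ 0 := by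
        rintro rfl
        exact hP0 (by rw [hPF, zero_modByMonic])
      have h := cpf_main K p D N hN0 hdegN hDF
      omega
    · -- live fat square with `g₀(1) = 0`: `(X − 1)² ∣ N` forces `N = 0`
      have hc0 : c 0 ≠ 0 := fun h => hW0 (by rw [h, C_0, zero_mul])
      have hg01 : (g 0).eval 1 = 0 := by
        rcases mul_eq_zero.1 hA with h | h
        · exact absurd h hc0
        · exact (pow_eq_zero_iff two_ne_zero).1 h
      have hW2 : (X - C (1 : K)) ^ 2 ∣ C (c 0) * g 0 ^ 2 :=
        Dvd.dvd.mul_left (pow_dvd_pow_of_dvd (dvd_iff_isRoot.2 hg01) 2) _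
      have hN2dvd : (X - C (1 : K)) ^ 2 ∣ N :=
        (dvd_add_right hW2).1 ((pow_dvd_pow _ hD2).trans hDF)
      have hN0 : N = 0 := by
        by_contra hN0
        have h := cpf_main K p 2 N hN0 hdegN hN2dvd
        omega
      rw [hN0, add_zero] at hDF
      have h := tcs_depth_sq_le K p (c 0) (g 0) D hW0 (hdeg 0) hDF
      omega
  · -- Case B: `N(1) = −c₀ g₀(1)² ≠ 0`.
    have hN1 : N.eval 1 ≠ 0 := by
      intro h
      rw [h, add_zero] at hF1
      exact hA hF1
    have hN0 : N ≠ 0 := by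
      rintro rfl
      exact hN1 eval_zero
    have hc0 : c 0 ≠ 0 := fun h => hA (by rw [h, zero_mul])
    have hg01 : (g 0).eval 1 ≠ 0 := fun h => hA (by rw [h, zero_pow two_ne_zero, mul_zero])
    have ht : 1 ≤ (g 0).support.card := by
      refine Finset.card_pos.2 (support_nonempty.2 ?_)
      intro h
      rw [h, eval_zero] at hg01
      exact hg01 rfl
    -- the operator `𝒟g₀ = 2 N g₀′ − N′ g₀` and the key identity `c₀ g₀ · 𝒟g₀ = N F′ − N′ F`
    obtain ⟨V₀, hV₀⟩ : ∃ V₀ : K[X], V₀ = 2 * (N * derivative (g 0)) - derivative N * g 0 := ⟨_, rfl⟩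
    have key : C (c 0) * g 0 * V₀ = N * derivative (C (c 0) * g 0 ^ 2 + N)
        - derivative N * (C (c 0) * g 0 ^ 2 + N) := by
      rw [hV₀, sq]
      simp only [derivative_add, derivative_mul, derivative_C, zero_mul, zero_add]
      ring
    have hD1F' : (X - C (1 : K)) ^ (D - 1) ∣ derivative (C (c 0) * g 0 ^ 2 + N) :=
      pow_sub_one_dvd_derivative_of_pow_dvd hDF
    have hD1F : (X - C (1 : K)) ^ (D - 1) ∣ C (c 0) * g 0 ^ 2 + N :=
      (pow_dvd_pow _ (Nat.sub_le D 1)).trans hDF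
    have hD1V₀ : (X - C (1 : K)) ^ (D - 1) ∣ V₀ := by
      have h : (X - C (1 : K)) ^ (D - 1) ∣ C (c 0) * g 0 * V₀ := by
        rw [key]
        exact dvd_sub (dvd_mul_of_dvd_right hD1F' _) (dvd_mul_of_dvd_right hD1F _)
      rw [mul_assoc, (isUnit_C.2 hc0.isUnit).dvd_mul_left] at h
      have hcop : IsCoprime ((X - C (1 : K)) ^ (D - 1)) (g 0) :=
        ((irreducible_X_sub_C (1 : K)).coprime_iff_not_dvd.2
          (fun hdvd => hg01 (dvd_iff_isRoot.1 hdvd).eq_zero)).pow_left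
      exact hcop.dvd_of_dvd_mul_left h
    -- sparsity: `#supp 𝒟g₀ ≤ #supp N · t ≤ 2t`, and the same for its fold `V`
    have hV₀card : V₀.support.card ≤ 2 * (g 0).support.card := by
      rw [hV₀]
      exact (tcm_card_support_op_le N (g 0)).trans (Nat.mul_le_mul_right _ hN2)
    obtain ⟨V, hV⟩ : ∃ V : K[X], V = V₀ %ₘ (X ^ p - 1) := ⟨_, rfl⟩
    have hVcard : V.support.card ≤ 2 * (g 0).support.card :=
      hV ▸ (card_support_fold_le p hp V₀).trans hV₀card
    have hVdeg : V.natDegree < p := hV ▸ tcm_natDegree_fold_lt p _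
    have hVdvd : (X - C (1 : K)) ^ (D - 1) ∣ V :=
      hV ▸ (tcm_pow_dvd_fold_iff p (by omega) V₀).2 hD1V₀
    by_cases hVz : V = 0
    swap
    · -- (B1) `V ≠ 0`: Hajós bound for `V`
      have h := cpf_main K p (D - 1) V hVz hVdeg hVdvd
      omega
    -- (B2) `V = 0`: `X^p − 1 ∣ 𝒟g₀`, hence `X^p − 1 ∣ N P′ − N′ P`
    have hqV₀ : (X : K[X]) ^ p - 1 ∣ V₀ := (modByMonic_eq_zero_iff_dvd hmonic).1 (hV ▸ hVz)
    obtain ⟨w, hw⟩ : ∃ w : K[X], C (c 0) * g 0 ^ 2 + N = P + (X ^ p - 1) * w :=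
      ⟨(C (c 0) * g 0 ^ 2 + N) /ₘ (X ^ p - 1), by rw [hPF, modByMonic_add_div]⟩
    have hq' : derivative ((X : K[X]) ^ p - 1) = 0 := by
      rw [derivative_sub, derivative_X_pow, derivative_one, CharP.cast_eq_zero, C_0, zero_mul,
        sub_zero]
    have hqW : (X : K[X]) ^ p - 1 ∣ N * derivative P - derivative N * P := by
      have h : (X : K[X]) ^ p - 1 ∣ C (c 0) * g 0 * V₀ := dvd_mul_of_dvd_right hqV₀ _
      rw [key, hw, derivative_add, derivative_mul, hq', zero_mul, zero_add] at h
      have e : N * (derivative P + (X ^ p - 1) * derivative w)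
          - derivative N * (P + (X ^ p - 1) * w)
          = N * derivative P - derivative N * P
            + (X ^ p - 1) * (N * derivative w - derivative N * w) := by ring
      rw [e] at h
      exact (dvd_add_left (dvd_mul_right _ _)).1 h
    -- Wronskian rigidity: `P = κ N` with `κ = P(1) / N(1)`
    obtain ⟨κ, hκ⟩ : ∃ κ : K, κ = P.eval 1 / N.eval 1 := ⟨_, rfl⟩
    have hE0 : P - C κ * N = 0 := by
      refine tcm_wronskian_rigidity p N (P - C κ * N) hN1 ?_ ?_ ?_
      · rw [eval_sub, eval_mul, eval_C, hκ, div_mul_cancel₀ _ hN1, sub_self]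
      · exact lt_of_le_of_lt (natDegree_sub_le _ _)
          (max_lt hdegP (lt_of_le_of_lt (natDegree_C_mul_le _ _) hdegN))
      · have e : N * derivative (P - C κ * N) - derivative N * (P - C κ * N)
            = N * derivative P - derivative N * P := by
          rw [derivative_sub, derivative_C_mul]
          ring
        rwa [e]
    rw [sub_eq_zero] at hE0
    have hκ0 : κ ≠ 0 := by
      rintro rfl
      exact hP0 (by rw [hE0, C_0, zero_mul])
    rw [hE0, (isUnit_C.2 hκ0.isUnit).dvd_mul_left] at hD
    have h := cpf_main K p D N hN0 hdegN hD
    omega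

end Summit.ValiantsHypothesis.ValiantsHypothesis.Theorems.CharPSparseSOSTwoCusp
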